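import Mathlib.Analysis.Calculus.ContDiff.Polynomial
import Literature.Analysis.Calculus.DividedDerivatives
import Literature.NumberTheory.Irrationality.KrattenthalerRivoal2007.DenominatorsTheorem
import Literature.NumberTheory.Irrationality.KrattenthalerRivoal2007.WellPoisedSumAsBaileyChain
import HarnessLib

/-!
# Partial-fraction coefficients as Taylor coefficients: `c_{l,j} = (1/(A−l)!) ∂^{A−l}(R(k)(k+j)^A)|_{k=−j}`

[KrattenthalerRivoal2007, §2.4 (eq:p_l)–(eq:expressionp_mnplusexplicite)] pass from the partial-fraction
decomposition `R_n(k) = Σ_{j=0}^{n} Σ_{l=1}^{A} c_{l,j,n}/(k+j)^l` of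
`R_n(k) = n!^{A−2Br}(k+n/2)(k−rn)_{rn}^B(k+n+1)_{rn}^B/(k)_{n+1}^A` to the Taylor coefficients
`c_{l,j,n} = (1/(A−l)!) ∂^{A−l}/∂k^{A−l} (R_n(k)(k+j)^A)|_{k=−j}` ("folklore" for partial fractions), and then
compute `R_n(−j+ε) ε^A` explicitly: up to the factor `(−1)^{Aj+Brn}(rn)!^{2B}/n!^{2rB}` it is the `j`-th summand of
the uniform very-well-poised series `S_{A,B,r}(n)` of §9–§10 (eq:expressionp_mnplusexplicite). This file
proves both steps for the tree's typing of Théorème 1 (`DenominatorsTheorem.lean`: data `c` with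
`IsPartialFractionData n A B r c`, `c o p` = coefficient of `1/(k+p)^{o+1}`):

* `BallRivoal.pfEval_coeff_eq_divDeriv` — the general fact: if `G` is smooth at the pole `t = −(p+1)` and agrees
  with `pfEval n K c t · (t+p+1)^K` on a punctured neighbourhood, then `c o p = 𝒟_{K−1−o} G(−(p+1))`
  (`𝒟_a = (1/a!) d^a/dt^a`, the tree's `divDeriv`).
* `regR n A B r j ε = R_n(ε − j) · ε^A` (regularised: `numeratorR(ε−j)/∏_{q≤n, q≠j}(ε−j+q)^A`) and
  **`IsPartialFractionData.coeff_eq_divDeriv`**: `c (l−1) j = 𝒟_{A−l} (regR n A B r j) 0` for `j ≤ n`, `1 ≤ l ≤ A`.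
* **`regR_dictionary`** — KR's (eq:expressionp_mnplusexplicite) in the polynomial vocabulary of
  `WellPoisedSumAsBaileyChain.lean`: off the other poles,
  `((−1)^A)^j · regR(ε) · 2((1−ε)_n(1+ε)_n)^{A+B} · n!^{2Br}
     = ((−1)^{rn})^B n!^A ((1−ε)_{rn}(1+ε)_{rn})^B (n+2ε−2j) φ_j(ε)^{A+B} ψ_j(ε)^B`,
  i.e. `(−1)^{Aj} R_n(−j+ε)ε^A = (−1)^{Brn} c_{A,B,r,n}(ε) × [j-th summand of wpTaylorSum ε n A B r]` with the unit
  `c(ε) = n!^A((1−ε)_{rn}(1+ε)_{rn})^B/(2 n!^{2Br}((1−ε)_n(1+ε)_n)^{A+B})` of that file's dictionary. Summing over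
  `j` with the weights `((−1)^A)^j` is exactly `p_{l,n}((−1)^A)` of Théorème 1 (i) (`pCoeff`), so Proposition 6/7
  (`d_n^{h−1}(1/h!)∂^h S_{A,B,r}(n)|₀ ∈ ℤ`-type statements) transfer to the `c`-data through these two theorems.

## References
* [KrattenthalerRivoal2007] C. Krattenthaler, T. Rivoal, *Hypergéométrie et fonction zêta de Riemann*,
  Mem. AMS 186 (2007), §2.4 and §12 (arXiv:math/0311114 pp. 7–8, 29).
-/

open Finset Filter Topology Polynomial
open scoped Nat
open Literature.Analysis.Calculus

namespace Literature.NumberTheory.Transcendental.BallRivoal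

/-- Off a point, continuity plus agreement on a punctured neighbourhood gives agreement of germs. [folklore] -/
private theorem eventuallyEq_of_puncturedNhds {f g : ℚ → ℚ} {x : ℚ} (hf : ContinuousAt f x)
    (hg : ContinuousAt g x) (h : ∀ᶠ t : ℚ in 𝓝[≠] x, f t = g t) : f =ᶠ[𝓝 x] g := by
  have hx : f x = g x := by
    have hf' : Tendsto f (𝓝[≠] x) (𝓝 (f x)) := hf.tendsto.mono_left nhdsWithin_le_nhds
    have hg' : Tendsto g (𝓝[≠] x) (𝓝 (g x)) := hg.tendsto.mono_left nhdsWithin_le_nhds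
    exact tendsto_nhds_unique (hf'.congr' h) hg'
  rw [eventually_nhdsWithin_iff] at h
  filter_upwards [h] with t ht
  by_cases htx : t = x
  · rw [htx, hx]
  · exact ht htx

/-- A punctured neighbourhood of the pole `−(p+1)` avoids all the poles `−1, …, −(n+1)`. [folklore] -/
private theorem eventually_good' (n p : ℕ) :
    ∀ᶠ t : ℚ in 𝓝[≠] (-((p : ℚ) + 1)), t + p + 1 ≠ 0 ∧ ∀ q : ℕ, q ≤ n → t + q + 1 ≠ 0 := by
  have h1 : ∀ᶠ t : ℚ in 𝓝[≠] (-((p : ℚ) + 1)), t ≠ -((p : ℚ) + 1) := eventually_mem_nhdsWithin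
  have h2 : ∀ q ∈ (range (n + 1)).erase p, ∀ᶠ t : ℚ in 𝓝 (-((p : ℚ) + 1)), t + q + 1 ≠ 0 := fun q hq => by
    have hqp : q ≠ p := (mem_erase.1 hq).1
    have hc : ContinuousAt (fun t : ℚ => t + q + 1) (-((p : ℚ) + 1)) := by fun_prop
    refine hc.eventually_ne ?_
    show (-((p : ℚ) + 1)) + q + 1 ≠ 0
    rw [show (-((p : ℚ) + 1) + q + 1) = (((q : ℤ) - p : ℤ) : ℚ) by push_cast; ring]
    exact_mod_cast sub_ne_zero.2 (by exact_mod_cast hqp : (q : ℤ) ≠ p)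
  have h2' := (eventually_all_finset _).2 h2
  filter_upwards [h1, mem_nhdsWithin_of_mem_nhds h2'] with t ht hall
  refine ⟨fun h => ht (by linarith), fun q hq => ?_⟩
  by_cases hqp : q = p
  · subst hqp
    exact fun h => ht (by linarith)
  · exact hall q (mem_erase.2 ⟨hqp, mem_range.2 (by omega)⟩)

/-- **Partial-fraction coefficients are Taylor coefficients of the regularised function** (the "folklore" step
`c_{l,j} = (1/(A−l)!) ∂^{A−l}(R(k)(k+j)^A)|_{k=−j}` of [KrattenthalerRivoal2007, §2.4 (eq:p_l)]): let `c` be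
partial-fraction data with poles `−1,…,−(n+1)` and orders `≤ K` (`pfEval n K c`), `p ≤ n`, and let `G` be smooth at
`−(p+1)` and equal to `pfEval n K c t · (t+p+1)^K` for `t ≠ −(p+1)` near `−(p+1)`. Then for `o < K`,
`𝒟_{K−1−o} G (−(p+1)) = c o p`. [cite: KrattenthalerRivoal2007, §2.4 (eq:p_l)] -/
theorem pfEval_coeff_eq_divDeriv (n K : ℕ) (c : ℕ → ℕ → ℚ) {G : ℚ → ℚ} {p : ℕ} (hp : p ≤ n)
    (hG : ContDiffAt ℚ (⊤ : ℕ∞) G (-((p : ℚ) + 1)))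
    (hgG : ∀ᶠ t : ℚ in 𝓝[≠] (-((p : ℚ) + 1)), G t = pfEval n K c t * (t + p + 1) ^ K)
    {o : ℕ} (ho : o < K) :
    divDeriv (K - 1 - o) G (-((p : ℚ) + 1)) = c o p := by
  set x : ℚ := -((p : ℚ) + 1) with hx
  -- the regular part `H` and the germ `F`
  set H : ℚ → ℚ := fun t => ∑ q ∈ (range (n + 1)).erase p, ∑ o' ∈ range K, c o' q / (t + q + 1) ^ (o' + 1)
    with hH
  set F : ℚ → ℚ := fun t => ∑ o' ∈ range K, c o' p * (t - x) ^ (K - 1 - o') + (t - x) ^ K * H t with hF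
  have hHs : ContDiffAt ℚ (⊤ : ℕ∞) H x := by
    refine ContDiffAt.sum fun q hq => ContDiffAt.sum fun o' _ => ?_
    have hqp : q ≠ p := (mem_erase.1 hq).1
    have hne : x + ((q : ℚ) + 1) ≠ 0 := by
      rw [hx, show (-((p : ℚ) + 1) + ((q : ℚ) + 1)) = (((q : ℤ) - p : ℤ) : ℚ) by push_cast; ring]
      exact_mod_cast sub_ne_zero.2 (by exact_mod_cast hqp : (q : ℤ) ≠ p)
    have h : ContDiffAt ℚ (⊤ : ℕ∞) (fun t : ℚ => c o' q * ((t + ((q : ℚ) + 1))⁻¹) ^ (o' + 1)) x :=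
      contDiffAt_const.mul ((contDiffAt_inv_add_const hne).pow (o' + 1))
    refine h.congr_of_eventuallyEq (Eventually.of_forall fun t => ?_)
    show c o' q / (t + q + 1) ^ (o' + 1) = c o' q * ((t + ((q : ℚ) + 1))⁻¹) ^ (o' + 1)
    rw [div_eq_mul_inv, inv_pow, add_assoc]
  have hterm : ∀ o' ∈ range K, ContDiffAt ℚ (⊤ : ℕ∞) (fun t : ℚ => c o' p * (t - x) ^ (K - 1 - o')) x :=
    fun o' _ => contDiffAt_const.mul (contDiffAt_sub_pow _ _ _)
  have hFs : ContDiffAt ℚ (⊤ : ℕ∞) F x :=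
    (ContDiffAt.sum fun s hs => hterm s hs).add ((contDiffAt_sub_pow _ _ _).mul hHs)
  -- `G = F` near `x`
  have hGF : G =ᶠ[𝓝 x] F := by
    refine eventuallyEq_of_puncturedNhds hG.continuousAt hFs.continuousAt ?_
    filter_upwards [hgG, eventually_good' n p] with t ht hgood
    rw [ht, pfEval, ← add_sum_erase _ _ (mem_range.2 (Nat.lt_succ_of_le hp)), hF, hH]
    simp only
    rw [add_mul, sum_mul, mul_comm _ (H t), show t - x = t + p + 1 by rw [hx]; ring]
    congr 1
    refine sum_congr rfl fun o' ho' => ?_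
    have ho'' := mem_range.1 ho'
    have hpow : (t + p + 1) ^ K = (t + p + 1) ^ (o' + 1) * (t + p + 1) ^ (K - 1 - o') := by
      rw [← pow_add]
      congr 1
      omega
    have hne := hgood.1
    rw [hpow]
    field_simp
  -- compute the divided derivative of `F`
  rw [divDeriv_congr hGF, hF]
  have hle : ((K - 1 - o : ℕ) : WithTop ℕ∞) ≤ ((⊤ : ℕ∞) : WithTop ℕ∞) :=
    WithTop.coe_le_coe.2 (le_top (a := ((K - 1 - o : ℕ) : ℕ∞)))
  have ha' : ContDiffAt ℚ ↑(K - 1 - o) (fun t => (t - x) ^ K * H t) x :=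
    ((contDiffAt_sub_pow _ _ _).mul hHs).of_le hle
  rw [divDeriv_fun_add ((ContDiffAt.sum fun s hs => hterm s hs).of_le hle) ha',
    divDeriv_sub_pow_mul (hHs.of_le hle) K, if_pos (by omega), add_zero,
    divDeriv_sum fun s hs => (hterm s hs).of_le hle]
  simp_rw [divDeriv_const_mul, divDeriv_sub_pow]
  rw [sum_eq_single_of_mem o (mem_range.2 ho)]
  · rw [if_pos rfl, mul_one]
  · intro s hs hso
    rw [if_neg (by have := mem_range.1 hs; omega), mul_zero]

end Literature.NumberTheory.Transcendental.BallRivoal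

namespace Literature.NumberTheory.Irrationality.KrattenthalerRivoal2007

open Literature.NumberTheory.Transcendental

/-- The regularised function `k ↦ R_{n,A,B,r}(k)(k+j)^A` at `k = ε − j`, i.e. `R_n(ε − j) · ε^A`:
`numeratorR(ε − j) / ∏_{q ≤ n, q ≠ j} (ε − j + q)^A` (the factor `(k+j)^A = ε^A` cancelled against the pole of
`1/(k)_{n+1}^A`). [cite: KrattenthalerRivoal2007, §2.4 (eq:p_l)] -/
noncomputable def regR (n A B r j : ℕ) (ε : ℚ) : ℚ :=
  (numeratorR n A B r).eval (ε - j) / (∏ q ∈ (range (n + 1)).erase j, (ε - j + q)) ^ A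

/-- `regR` is smooth off the other poles. [cite: KrattenthalerRivoal2007, §2.4 (eq:p_l)] -/
theorem contDiffAt_regR (n A B r j : ℕ) {ε : ℚ} (hε : ∀ q ∈ (range (n + 1)).erase j, ε - j + q ≠ 0)
    {N : WithTop ℕ∞} : ContDiffAt ℚ N (regR n A B r j) ε := by
  have hnum : ContDiff ℚ N (fun ε : ℚ => (numeratorR n A B r).eval (ε - j)) := by
    have h := (Polynomial.contDiff_aeval (𝕜 := ℚ) (numeratorR n A B r) N).comp
      (contDiff_id.sub (contDiff_const (c := (j : ℚ))))
    simpa [Function.comp_def] using h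
  have hden : ContDiff ℚ N (fun ε : ℚ => (∏ q ∈ (range (n + 1)).erase j, (ε - j + q)) ^ A) := by
    fun_prop
  have hne : (∏ q ∈ (range (n + 1)).erase j, (ε - j + q)) ^ A ≠ 0 :=
    pow_ne_zero _ (prod_ne_zero_iff.2 hε)
  exact hnum.contDiffAt.div hden.contDiffAt hne

/-- **Partial-fraction coefficients of `R_{n,A,B,r}` as Taylor coefficients**
([KrattenthalerRivoal2007, §2.4 (eq:p_l)]: `c_{l,j,n} = (1/(A−l)!) ∂^{A−l}/∂k^{A−l}(R_n(k)(k+j)^A)|_{k=−j}`): for data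
`c` with `IsPartialFractionData n A B r c`, `j ≤ n` and `1 ≤ l ≤ A`, `c (l−1) j = 𝒟_{A−l}(regR n A B r j)(0)`.
[cite: KrattenthalerRivoal2007, §2.4 (eq:p_l)] -/
theorem IsPartialFractionData.coeff_eq_divDeriv {n A B r : ℕ} {c : ℕ → ℕ → ℚ}
    (h : IsPartialFractionData n A B r c) {j : ℕ} (hj : j ≤ n) {l : ℕ} (hl1 : 1 ≤ l) (hlA : l ≤ A) :
    c (l - 1) j = divDeriv (A - l) (regR n A B r j) 0 := by
  have h0 : ∀ q ∈ (range (n + 1)).erase j, (0 : ℚ) - j + q ≠ 0 := fun q hq => by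
    have hqj : q ≠ j := (mem_erase.1 hq).1
    rw [show ((0 : ℚ) - j + q) = (((q : ℤ) - j : ℤ) : ℚ) by push_cast; ring]
    exact_mod_cast sub_ne_zero.2 (by exact_mod_cast hqj : (q : ℤ) ≠ j)
  -- the general fact, for `G t = regR (t + j + 1)`
  have hG : ContDiffAt ℚ (⊤ : ℕ∞) (fun t : ℚ => regR n A B r j (t + ((j : ℚ) + 1))) (-((j : ℚ) + 1)) := by
    have hreg : ContDiffAt ℚ (⊤ : ℕ∞) (regR n A B r j) ((-((j : ℚ) + 1)) + ((j : ℚ) + 1)) := by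
      rw [neg_add_cancel]
      exact contDiffAt_regR n A B r j h0
    exact hreg.comp (-((j : ℚ) + 1)) (contDiffAt_id.add contDiffAt_const)
  have hgG : ∀ᶠ t : ℚ in 𝓝[≠] (-((j : ℚ) + 1)),
      regR n A B r j (t + ((j : ℚ) + 1)) = BallRivoal.pfEval n A c t * (t + j + 1) ^ A := by
    filter_upwards [BallRivoal.eventually_good' n j] with t ht
    rw [h t ht.2, regR, show t + ((j : ℚ) + 1) - j = t + 1 by ring, BallRivoal.poch, ← mul_prod_erase _ _ (mem_range.2 (Nat.lt_succ_of_le hj)), mul_pow,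
      show t + (j : ℚ) + 1 = t + 1 + j by ring]
    have hne1 : (t + 1 + (j : ℚ)) ^ A ≠ 0 := by
      refine pow_ne_zero _ fun h' => ht.1 ?_
      linarith
    have hne2 : (∏ q ∈ (range (n + 1)).erase j, (t + 1 + (q : ℚ))) ^ A ≠ 0 := by
      refine pow_ne_zero _ (prod_ne_zero_iff.2 fun q hq h' => ?_)
      have hqn : q ≤ n := Nat.lt_succ_iff.1 (mem_range.1 (mem_of_mem_erase hq))
      exact ht.2 q hqn (by linarith)
    field_simp
  have := BallRivoal.pfEval_coeff_eq_divDeriv n A c hj hG hgG (o := l - 1) (by omega)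
  rw [show A - 1 - (l - 1) = A - l by omega, divDeriv_comp_add_const] at this
  rw [← this, neg_add_cancel]

/-! ### The dictionary `R_n(−j+ε)ε^A` ↔ the `j`-th summand of `S_{A,B,r}(n)` -/

/-- Reflection: `∏_{q<m} (x − m + q) = (−1)^m ∏_{i<m} (1 − x + i)`. [folklore] -/
private theorem prod_range_reflect_neg (x : ℚ) (m : ℕ) :
    ∏ q ∈ range m, (x - m + q) = (-1) ^ m * ∏ i ∈ range m, (1 - x + i) := by
  induction m generalizing x with
  | zero => simp
  | succ m ih =>
    rw [prod_range_succ, prod_range_succ', pow_succ]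
    have h := ih (x - 1)
    have h1 : ∏ q ∈ range m, (x - ((m + 1 : ℕ) : ℚ) + q) = ∏ q ∈ range m, (x - 1 - (m : ℚ) + q) :=
      prod_congr rfl fun q _ => by push_cast; ring
    have h2 : ∏ i ∈ range m, (1 - (x - 1) + (i : ℚ)) = ∏ i ∈ range m, (1 - x + ((i + 1 : ℕ) : ℚ)) :=
      prod_congr rfl fun i _ => by push_cast; ring
    rw [h1, h, h2]
    push_cast
    ring

/-- `∏_{q ≤ n, q ≠ j} (ε − j + q) = (−1)^j (1−ε)_j (1+ε)_{n−j}`. [folklore] -/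
private theorem prod_erase_eq (n j : ℕ) (hj : j ≤ n) (ε : ℚ) :
    ∏ q ∈ (range (n + 1)).erase j, (ε - j + q) =
      (-1) ^ j * (∏ i ∈ range j, (1 - ε + i)) * ∏ i ∈ range (n - j), (1 + ε + i) := by
  have hsplit : (range (n + 1)).erase j = range j ∪ Ico (j + 1) (n + 1) := by
    ext q
    simp only [mem_erase, mem_range, mem_union, mem_Ico]
    omega
  have hdisj : Disjoint (range j) (Ico (j + 1) (n + 1)) := by
    rw [disjoint_left]
    intro q hq hq'
    rw [mem_range] at hq
    rw [mem_Ico] at hq'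
    omega
  rw [hsplit, prod_union hdisj, prod_range_reflect_neg ε j, prod_Ico_eq_prod_range,
    show n + 1 - (j + 1) = n - j by omega]
  congr 1
  exact prod_congr rfl fun i _ => by push_cast; ring

/-- The numerator at `k = ε − j`:
`numeratorR(ε−j) = (n!^A/n!^{2Br}) (ε−j+n/2) ((−1)^{rn}(j+1−ε)_{rn})^B ((n−j+1+ε)_{rn})^B`. [folklore] -/
private theorem eval_numeratorR (n A B r j : ℕ) (hj : j ≤ n) (ε : ℚ) :
    (numeratorR n A B r).eval (ε - j) =
      (n ! : ℚ) ^ A / (n ! : ℚ) ^ (2 * B * r) * (ε - j + (n : ℚ) / 2) *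
        ((-1) ^ (r * n) * ∏ i ∈ range (r * n), ((j : ℚ) + 1 - ε + i)) ^ B *
          (∏ i ∈ range (r * n), (((n - j : ℕ) : ℚ) + 1 + ε + i)) ^ B := by
  simp only [numeratorR, eval_mul, eval_pow, eval_prod, eval_add, eval_X, eval_C]
  have h1 : ∏ i ∈ range (r * n), (ε - j + ((i : ℚ) - ((r * n : ℕ) : ℚ))) =
      (-1) ^ (r * n) * ∏ i ∈ range (r * n), ((j : ℚ) + 1 - ε + i) := by
    rw [show (∏ i ∈ range (r * n), (ε - j + ((i : ℚ) - ((r * n : ℕ) : ℚ)))) =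
        ∏ q ∈ range (r * n), (ε - j - ((r * n : ℕ) : ℚ) + q) from prod_congr rfl fun i _ => by ring,
      prod_range_reflect_neg (ε - j) (r * n)]
    congr 1
    exact prod_congr rfl fun i _ => by ring
  have h2 : ∏ i ∈ range (r * n), (ε - j + ((n + 1 + i : ℕ) : ℚ)) =
      ∏ i ∈ range (r * n), (((n - j : ℕ) : ℚ) + 1 + ε + i) :=
    prod_congr rfl fun i _ => by push_cast [Nat.cast_sub hj]; ring
  rw [h1, h2]
  ring

/-- **KR's (eq:expressionp_mnplusexplicite), regularised and in polynomial form**: for `j ≤ n` and `ε` off the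
other poles (`ε − j + q ≠ 0` for `q ≤ n`, `q ≠ j`; in particular for `|ε| < 1`),
`((−1)^A)^j · R_n(ε−j)ε^A · 2((1−ε)_n(1+ε)_n)^{A+B} · n!^{2Br}
   = ((−1)^{rn})^B · n!^A · ((1−ε)_{rn}(1+ε)_{rn})^B · (n+2ε−2j) · φ_j(ε)^{A+B} · ψ_j(ε)^B`
(`phiKR`, `psiKR` of `WellPoisedSumAsBaileyChain`): i.e. `(−1)^{Aj} R_n(−j+ε) ε^A` is `(−1)^{Brn}` times the unit
`c(ε) = n!^A((1−ε)_{rn}(1+ε)_{rn})^B/(2n!^{2Br}((1−ε)_n(1+ε)_n)^{A+B})` times the `j`-th summand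
`(n+2ε−2j)φ_j^{A+B}ψ_j^B` of `wpTaylorSum ε n A B r` — KR: `R_n(−j+ε)ε^A·(−1)^{Aj} = (−1)^{Brn}(rn)!^{2B}/n!^{2rB} ×
(n/2−j+ε)(n!/((1−ε)_j(1+ε)_{n−j}))^A (binom(rn+j−ε, rn) binom((r+1)n−j+ε, rn))^B`.
[cite: KrattenthalerRivoal2007, §12 proof of Proposition 6, (eq:expressionp_mn)–(eq:expressionp_mnplusexplicite)] -/
theorem regR_dictionary (n A B r j : ℕ) (hj : j ≤ n) {ε : ℚ}
    (hε : ∀ q ∈ (range (n + 1)).erase j, ε - j + q ≠ 0) :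
    ((-1 : ℚ) ^ A) ^ j * regR n A B r j ε *
        (2 * ((∏ i ∈ range n, (1 - ε + i)) * ∏ i ∈ range n, (1 + ε + i)) ^ (A + B)) *
          (n ! : ℚ) ^ (2 * B * r) =
      ((-1 : ℚ) ^ (r * n)) ^ B * (n ! : ℚ) ^ A *
        ((∏ i ∈ range (r * n), (1 - ε + i)) * ∏ i ∈ range (r * n), (1 + ε + i)) ^ B *
          ((n : ℚ) + 2 * ε - 2 * j) * phiKR ε n j ^ (A + B) * psiKR ε n r j ^ B := by
  have hE := prod_erase_eq n j hj ε
  have hE0 : ∏ q ∈ (range (n + 1)).erase j, (ε - j + q) ≠ 0 := prod_ne_zero_iff.2 hε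
  rw [regR, eval_numeratorR n A B r j hj, hE, phiKR, psiKR]
  rw [hE] at hE0
  -- the atoms
  set P1 := ∏ i ∈ range j, (1 - ε + (i : ℚ)) with hP1
  set P2 := ∏ i ∈ range (n - j), (1 + ε + (i : ℚ)) with hP2
  set Φa := ∏ i ∈ range (n - j), (1 - ε + (j : ℚ) + i) with hΦa
  set Φb := ∏ i ∈ range j, (1 + ε + ((n - j : ℕ) : ℚ) + i) with hΦb
  set U1 := ∏ i ∈ range (r * n), ((j : ℚ) + 1 - ε + i) with hU1
  set U2 := ∏ i ∈ range (r * n), (((n - j : ℕ) : ℚ) + 1 + ε + i) with hU2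
  set V1 := ∏ i ∈ range (r * n), (1 - ε + (i : ℚ)) with hV1
  set V2 := ∏ i ∈ range (r * n), (1 + ε + (i : ℚ)) with hV2
  set W1 := ∏ i ∈ range j, (((r * n : ℕ) : ℚ) + 1 - ε + i) with hW1
  set W2 := ∏ i ∈ range (n - j), (((r * n : ℕ) : ℚ) + 1 + ε + i) with hW2
  -- splitting the Pochhammer symbols
  have hD1 : ∏ i ∈ range n, (1 - ε + (i : ℚ)) = P1 * Φa := by
    have h := prod_range_add (fun i : ℕ => (1 - ε + (i : ℚ))) j (n - j)
    rw [show j + (n - j) = n by omega] at h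
    rw [h, hP1, hΦa]
    congr 1
    exact prod_congr rfl fun i _ => by push_cast; ring
  have hD2 : ∏ i ∈ range n, (1 + ε + (i : ℚ)) = P2 * Φb := by
    have h := prod_range_add (fun i : ℕ => (1 + ε + (i : ℚ))) (n - j) j
    rw [show n - j + j = n by omega] at h
    rw [h, hP2, hΦb]
    congr 1
    exact prod_congr rfl fun i _ => by push_cast; ring
  have hUV1 : U1 * P1 = V1 * W1 := by
    have h := prod_range_add (fun i : ℕ => (1 - ε + (i : ℚ))) j (r * n)
    have h' := prod_range_add (fun i : ℕ => (1 - ε + (i : ℚ))) (r * n) j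
    rw [show j + r * n = r * n + j by omega, h'] at h
    have e1 : ∏ i ∈ range (r * n), (1 - ε + ((j + i : ℕ) : ℚ)) = U1 :=
      (prod_congr rfl fun i _ => by push_cast; ring).trans hU1.symm
    have e2 : ∏ i ∈ range j, (1 - ε + ((r * n + i : ℕ) : ℚ)) = W1 :=
      (prod_congr rfl fun i _ => by push_cast; ring).trans hW1.symm
    rw [e1, e2] at h
    rw [← hP1, ← hV1] at h
    linear_combination -h
  have hUV2 : P2 * U2 = V2 * W2 := by
    have h := prod_range_add (fun i : ℕ => (1 + ε + (i : ℚ))) (n - j) (r * n)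
    have h' := prod_range_add (fun i : ℕ => (1 + ε + (i : ℚ))) (r * n) (n - j)
    rw [show n - j + r * n = r * n + (n - j) by omega, h'] at h
    have e1 : ∏ i ∈ range (r * n), (1 + ε + ((n - j + i : ℕ) : ℚ)) = U2 :=
      (prod_congr rfl fun i _ => by push_cast [Nat.cast_sub hj]; ring).trans hU2.symm
    have e2 : ∏ i ∈ range (n - j), (1 + ε + ((r * n + i : ℕ) : ℚ)) = W2 :=
      (prod_congr rfl fun i _ => by push_cast; ring).trans hW2.symm
    rw [e1, e2] at h
    rw [← hP2, ← hV2] at h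
    linear_combination -h
  have hrel : (U1 * U2 * (P1 * P2)) ^ B = (V1 * V2 * (W1 * W2)) ^ B := by
    rw [show U1 * U2 * (P1 * P2) = (U1 * P1) * (P2 * U2) by ring, hUV1, hUV2]
    ring
  -- nonvanishing
  have hs : ((-1 : ℚ) ^ j) ^ A ≠ 0 := pow_ne_zero _ (pow_ne_zero _ (by norm_num))
  have hP12 : (P1 * P2) ^ A ≠ 0 := by
    refine pow_ne_zero _ fun h => hE0 ?_
    rw [mul_assoc, h, mul_zero]
  have hn : (n ! : ℚ) ^ (2 * B * r) ≠ 0 := by positivity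
  have hF : (n ! : ℚ) ^ (2 * B * r) * ((n ! : ℚ) ^ A / (n ! : ℚ) ^ (2 * B * r)) = (n ! : ℚ) ^ A :=
    mul_div_cancel₀ _ hn
  rw [hD1, hD2, pow_right_comm]
  calc ((-1 : ℚ) ^ j) ^ A *
        ((n ! : ℚ) ^ A / (n ! : ℚ) ^ (2 * B * r) * (ε - j + (n : ℚ) / 2) * ((-1) ^ (r * n) * U1) ^ B * U2 ^ B /
          ((-1) ^ j * P1 * P2) ^ A) *
        (2 * (P1 * Φa * (P2 * Φb)) ^ (A + B)) * (n ! : ℚ) ^ (2 * B * r)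
      = (((-1 : ℚ) ^ j) ^ A * (((-1 : ℚ) ^ j) ^ A)⁻¹) * ((P1 * P2) ^ A * ((P1 * P2) ^ A)⁻¹) *
          ((n ! : ℚ) ^ (2 * B * r) * ((n ! : ℚ) ^ A / (n ! : ℚ) ^ (2 * B * r))) *
          (((-1 : ℚ) ^ (r * n)) ^ B * ((n : ℚ) + 2 * ε - 2 * j) * (Φa * Φb) ^ (A + B) *
            (U1 * U2 * (P1 * P2)) ^ B) := by
        rw [div_eq_mul_inv _ (((-1 : ℚ) ^ j * P1 * P2) ^ A), show ((-1 : ℚ) ^ j * P1 * P2) ^ A =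
          ((-1 : ℚ) ^ j) ^ A * (P1 * P2) ^ A by ring, mul_inv]
        ring
    _ = ((-1 : ℚ) ^ (r * n)) ^ B * (n ! : ℚ) ^ A * (V1 * V2) ^ B * ((n : ℚ) + 2 * ε - 2 * j) *
          (Φa * Φb) ^ (A + B) * (W1 * W2) ^ B := by
        rw [mul_inv_cancel₀ hs, mul_inv_cancel₀ hP12, hF, hrel]
        ring

end Literature.NumberTheory.Irrationality.KrattenthalerRivoal2007
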